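import Summits.QuantumFields.QCD.Theses.HeatSlicedQuarks
import Literature.MathematicalPhysics.QuantumLattice.OverlapLocality
import Summits.QuantumFields.QCD.Theorems.ActionBoundsLowModes.Negative.LoadBearing
import Summits.QuantumFields.QCD.Theorems.HeatSlicedQuarksActionBoundsLowModesStubNaiveKineticDefects

/-!
# Stub `stub_naiveKinetic` of line `Sketch` (idea `drop-the-wilson-square`)
(crux `Summit.QuantumFields.QCD.Theses.HeatSlicedQuarks.ActionBoundsLowModes`, item stmt-QuantumFields-8872,
route route-QuantumFields-HeatSlicedQuarks)

**Statement.** `∃ C, ∀ L U m v`, `Re⟨v, T_naive(U) v⟩ ≤ 4 Σ_i |(D_W(U,m,1) v)_i|² + C Σ_x V(U,x) |v(x)|²`,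
where `T_naive = (Σ_μ a_μᴴ a_μ) ⊗ 1₄` (reindexed to site × colour × spin), `a_μ = F_μ − F_μᴴ`,
`F_μ = linkHop ρ₃ U μ` the unitary `U`-twisted shift, and `V(U,x) = Σ_{dist(x,y)≤3} Σ_{μ,ν} √(3 − Re tr U_{y,μν})`.

**Proof (Neuberger's square completion, hep-lat/9911004, with commutators paid by plaquettes).**
Abstractly, for ANY four matrices `F_μ` and real `r` (section `Algebra`): with `b_μ = F_μ + F_μᴴ`,
`M = r − Σ_μ b_μ ⊗ 1` (Hermitian), `A = Σ_μ a_μ ⊗ γ_μ` (skew), one has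
`‖(M+A)w‖² = ‖Mw‖² + ‖Aw‖² + Re⟨w,[M,A]w⟩`, `[M,A] = −Σ_{μν} [b_μ,a_ν] ⊗ γ_ν`, and, pairing
`(μ,ν)` with `(ν,μ)` through `{γ_μ,γ_ν} = 2δ_{μν}`,
`⟨w, T_naive w⟩ = ‖Aw‖² − ½ Σ_{μν} ⟨w, (a_μᴴa_ν − a_νᴴa_μ) ⊗ γ_μγ_ν w⟩`; both `[b_μ,a_ν]` and
`a_μᴴa_ν − a_νᴴa_μ` are signed sums of the four commutators `[F_μ^♯, F_ν^♭]`, so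
`Re⟨w,T_naive w⟩ ≤ ‖(M+A)w‖² + 96 B` whenever every `|⟨w,([F_μ^♯,F_ν^♭] ⊗ Γ)w⟩| ≤ B` for `|Γ_{αβ}| ≤ 1`
(`abstract_naiveKinetic_le`).  Concretely `2 D_W(U,m,1) = M + A` after `reindex` (`two_smul_core`,
`r = 2(m+4)`, from `wilsonDirac_eq_sub_sum_wilsonHop`), so `‖(M+A)w‖² = 4‖D_W v‖²`, and the commutator
bounds with `B = 432 Σ_x V(U,x)|w(x)|²` are the four theorems of `…StubNaiveKineticDefects` (each
commutator is a single-offset matrix whose coefficient is a conjugated plaquette defect `ρ₃(U_□) − 1`,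
Schur test).  Hence `C = 96 · 432 = 41472`; `m` only enters the dropped `‖Mw‖²`.  No named facts used.
-/

namespace Summit.QuantumFields.QCD.Cruxes.ActionBoundsLowModes.DropTheWilsonSquare

open Literature.MathematicalPhysics Literature.MathematicalPhysics.QuantumLattice
  Literature.MathematicalPhysics.QuantumFieldTheory Literature.Probability.LatticeModels
open Matrix
open scoped Kronecker ComplexOrder

/-! ## Abstract Neuberger algebra: four matrices `F_μ` and the gamma matrices -/

section Algebra

variable {n : Type*}

/-- `Z ⊗ (−Γ) = −(Z ⊗ Γ)`. -/
theorem kronecker_neg {l m p q : Type*} (A : Matrix l m ℂ) (B : Matrix p q ℂ) :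
    A ⊗ₖ (-B) = -(A ⊗ₖ B) := by
  ext ⟨i, j⟩ ⟨k, l⟩
  simp [Matrix.kroneckerMap_apply]

/-- `⟨w, (Σ_i X_i) w⟩ = Σ_i ⟨w, X_i w⟩`. -/
theorem form_sum [Fintype n] {κ : Type*} (s : Finset κ) (X : κ → Matrix n n ℂ) (w : n → ℂ) :
    star w ⬝ᵥ ((∑ i ∈ s, X i) *ᵥ w) = ∑ i ∈ s, star w ⬝ᵥ (X i *ᵥ w) := by
  rw [Matrix.sum_mulVec, dotProduct_sum]

/-- Triangle inequality for the form of a signed sum of four Kronecker terms. -/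
theorem norm_form_four_le [Fintype n] {k : Type*} [Fintype k] (Z₁ Z₂ Z₃ Z₄ : Matrix n n ℂ)
    (Γ : Matrix k k ℂ) (w : n × k → ℂ) (B : ℝ)
    (h₁ : ‖star w ⬝ᵥ ((Z₁ ⊗ₖ Γ) *ᵥ w)‖ ≤ B) (h₂ : ‖star w ⬝ᵥ ((Z₂ ⊗ₖ Γ) *ᵥ w)‖ ≤ B)
    (h₃ : ‖star w ⬝ᵥ ((Z₃ ⊗ₖ Γ) *ᵥ w)‖ ≤ B) (h₄ : ‖star w ⬝ᵥ ((Z₄ ⊗ₖ Γ) *ᵥ w)‖ ≤ B) :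
    ‖star w ⬝ᵥ (((Z₁ - Z₂ - Z₃ + Z₄) ⊗ₖ Γ) *ᵥ w)‖ ≤ 4 * B := by
  rw [add_kronecker, sub_kronecker, sub_kronecker, add_mulVec, sub_mulVec, sub_mulVec,
    dotProduct_add, dotProduct_sub, dotProduct_sub]
  calc _ ≤ ‖star w ⬝ᵥ ((Z₁ ⊗ₖ Γ) *ᵥ w) - star w ⬝ᵥ ((Z₂ ⊗ₖ Γ) *ᵥ w) -
        star w ⬝ᵥ ((Z₃ ⊗ₖ Γ) *ᵥ w)‖ + ‖star w ⬝ᵥ ((Z₄ ⊗ₖ Γ) *ᵥ w)‖ := norm_add_le _ _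
    _ ≤ ‖star w ⬝ᵥ ((Z₁ ⊗ₖ Γ) *ᵥ w) - star w ⬝ᵥ ((Z₂ ⊗ₖ Γ) *ᵥ w)‖ +
        ‖star w ⬝ᵥ ((Z₃ ⊗ₖ Γ) *ᵥ w)‖ + ‖star w ⬝ᵥ ((Z₄ ⊗ₖ Γ) *ᵥ w)‖ := by
          gcongr; exact norm_sub_le _ _
    _ ≤ ‖star w ⬝ᵥ ((Z₁ ⊗ₖ Γ) *ᵥ w)‖ + ‖star w ⬝ᵥ ((Z₂ ⊗ₖ Γ) *ᵥ w)‖ +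
        ‖star w ⬝ᵥ ((Z₃ ⊗ₖ Γ) *ᵥ w)‖ + ‖star w ⬝ᵥ ((Z₄ ⊗ₖ Γ) *ᵥ w)‖ := by
          gcongr; exact norm_sub_le _ _
    _ ≤ 4 * B := by linarith

/-- **Neuberger's decomposition, doubled**: `2(c − Σ_μ W_μ) = M + A` with the Hermitian part
`M = 2c − Σ_μ (F_μ + F_μᴴ) ⊗ 1` and the gamma part `A = Σ_μ (F_μ − F_μᴴ) ⊗ γ_μ`, where
`W_μ = F_μ ⊗ ½(1−γ_μ) + F_μᴴ ⊗ ½(1+γ_μ)`. -/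
theorem two_smul_core [DecidableEq n] (F : Fin 4 → Matrix n n ℂ) (c : ℂ) :
    (2 : ℂ) • (c • (1 : Matrix (n × Fin 4) (n × Fin 4) ℂ) -
        ∑ μ, (F μ ⊗ₖ chiralProjMinus μ + (F μ)ᴴ ⊗ₖ chiralProjPlus μ)) =
      ((2 * c) • (1 : Matrix (n × Fin 4) (n × Fin 4) ℂ) -
          ∑ μ, ((F μ + (F μ)ᴴ) ⊗ₖ (1 : Matrix (Fin 4) (Fin 4) ℂ))) +
        ∑ μ, ((F μ - (F μ)ᴴ) ⊗ₖ euclideanGamma μ) := by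
  have key : ∀ μ, (2 : ℂ) • (F μ ⊗ₖ chiralProjMinus μ + (F μ)ᴴ ⊗ₖ chiralProjPlus μ) =
      (F μ + (F μ)ᴴ) ⊗ₖ (1 : Matrix (Fin 4) (Fin 4) ℂ) - (F μ - (F μ)ᴴ) ⊗ₖ euclideanGamma μ := by
    intro μ
    have h2 : (2 : ℂ) • chiralProjMinus μ = 1 - euclideanGamma μ := by
      rw [chiralProjMinus, smul_smul, mul_inv_cancel₀ two_ne_zero, one_smul]
    have h2' : (2 : ℂ) • chiralProjPlus μ = 1 + euclideanGamma μ := by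
      rw [chiralProjPlus, smul_smul, mul_inv_cancel₀ two_ne_zero, one_smul]
    rw [smul_add, ← kronecker_smul, ← kronecker_smul, h2, h2', kronecker_sub, kronecker_add,
      add_kronecker, sub_kronecker]
    abel
  rw [smul_sub, smul_smul, Finset.smul_sum, Finset.sum_congr rfl fun μ _ => key μ,
    Finset.sum_sub_distrib]
  abel

/-- The Hermitian part is Hermitian (real scalar). -/
theorem massPart_conjTranspose [DecidableEq n] (F : Fin 4 → Matrix n n ℂ) (r : ℝ) :
    ((r : ℂ) • (1 : Matrix (n × Fin 4) (n × Fin 4) ℂ) -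
        ∑ μ, ((F μ + (F μ)ᴴ) ⊗ₖ (1 : Matrix (Fin 4) (Fin 4) ℂ)))ᴴ =
      (r : ℂ) • (1 : Matrix (n × Fin 4) (n × Fin 4) ℂ) -
        ∑ μ, ((F μ + (F μ)ᴴ) ⊗ₖ (1 : Matrix (Fin 4) (Fin 4) ℂ)) := by
  rw [conjTranspose_sub, conjTranspose_smul, conjTranspose_one, Matrix.conjTranspose_sum]
  congr 1
  · rw [Complex.star_def, Complex.conj_ofReal]
  · refine Finset.sum_congr rfl fun μ _ => ?_
    rw [conjTranspose_kronecker, conjTranspose_one, conjTranspose_add, conjTranspose_conjTranspose,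
      add_comm]

/-- The gamma part is skew-Hermitian. -/
theorem gammaPart_conjTranspose (F : Fin 4 → Matrix n n ℂ) :
    (∑ μ, ((F μ - (F μ)ᴴ) ⊗ₖ euclideanGamma μ))ᴴ = -∑ μ, ((F μ - (F μ)ᴴ) ⊗ₖ euclideanGamma μ) := by
  rw [Matrix.conjTranspose_sum, ← Finset.sum_neg_distrib]
  refine Finset.sum_congr rfl fun μ _ => ?_
  rw [conjTranspose_kronecker, (euclideanGamma_isHermitian μ).eq, conjTranspose_sub,
    conjTranspose_conjTranspose, ← neg_kronecker, neg_sub]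

/-- **The commutator of the Hermitian and gamma parts**:
`[M, A] = −Σ_{μ,ν} [F_μ + F_μᴴ, F_ν − F_νᴴ] ⊗ γ_ν` (the scalar commutes with everything). -/
theorem comm_massPart_gammaPart [Fintype n] [DecidableEq n] (F : Fin 4 → Matrix n n ℂ) (c : ℂ) :
    (c • (1 : Matrix (n × Fin 4) (n × Fin 4) ℂ) -
          ∑ μ, ((F μ + (F μ)ᴴ) ⊗ₖ (1 : Matrix (Fin 4) (Fin 4) ℂ))) *
        (∑ ν, ((F ν - (F ν)ᴴ) ⊗ₖ euclideanGamma ν)) -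
      (∑ ν, ((F ν - (F ν)ᴴ) ⊗ₖ euclideanGamma ν)) *
        (c • (1 : Matrix (n × Fin 4) (n × Fin 4) ℂ) -
          ∑ μ, ((F μ + (F μ)ᴴ) ⊗ₖ (1 : Matrix (Fin 4) (Fin 4) ℂ))) =
      -∑ μ, ∑ ν, (((F μ + (F μ)ᴴ) * (F ν - (F ν)ᴴ) - (F ν - (F ν)ᴴ) * (F μ + (F μ)ᴴ)) ⊗ₖ
        euclideanGamma ν) := by
  have hBA : (∑ μ, ((F μ + (F μ)ᴴ) ⊗ₖ (1 : Matrix (Fin 4) (Fin 4) ℂ))) *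
      (∑ ν, ((F ν - (F ν)ᴴ) ⊗ₖ euclideanGamma ν)) =
        ∑ μ, ∑ ν, (((F μ + (F μ)ᴴ) * (F ν - (F ν)ᴴ)) ⊗ₖ euclideanGamma ν) := by
    rw [Finset.sum_mul]
    refine Finset.sum_congr rfl fun μ _ => ?_
    rw [Finset.mul_sum]
    refine Finset.sum_congr rfl fun ν _ => ?_
    rw [← mul_kronecker_mul, one_mul]
  have hAB : (∑ ν, ((F ν - (F ν)ᴴ) ⊗ₖ euclideanGamma ν)) *
      (∑ μ, ((F μ + (F μ)ᴴ) ⊗ₖ (1 : Matrix (Fin 4) (Fin 4) ℂ))) =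
        ∑ μ, ∑ ν, (((F ν - (F ν)ᴴ) * (F μ + (F μ)ᴴ)) ⊗ₖ euclideanGamma ν) := by
    rw [Finset.mul_sum]
    refine Finset.sum_congr rfl fun μ _ => ?_
    rw [Finset.sum_mul]
    refine Finset.sum_congr rfl fun ν _ => ?_
    rw [← mul_kronecker_mul, mul_one]
  rw [sub_mul, mul_sub, Matrix.smul_mul, Matrix.mul_smul, one_mul, mul_one, hBA, hAB]
  simp only [sub_kronecker, Finset.sum_sub_distrib]
  abel

/-- `a_μᴴ a_ν − a_νᴴ a_μ` as four `F`-commutators (`a = F − Fᴴ`). -/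
theorem skew_pair_expand [Fintype n] (P Q : Matrix n n ℂ) :
    (P - Pᴴ)ᴴ * (Q - Qᴴ) - (Q - Qᴴ)ᴴ * (P - Pᴴ) =
      (Pᴴ * Q - Q * Pᴴ) - (Pᴴ * Qᴴ - Qᴴ * Pᴴ) - (P * Q - Q * P) + (P * Qᴴ - Qᴴ * P) := by
  rw [conjTranspose_sub, conjTranspose_conjTranspose, conjTranspose_sub,
    conjTranspose_conjTranspose]
  noncomm_ring

/-- `[F_μ + F_μᴴ, F_ν − F_νᴴ]` as four `F`-commutators. -/
theorem sym_skew_expand [Fintype n] (P Q : Matrix n n ℂ) :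
    (P + Pᴴ) * (Q - Qᴴ) - (Q - Qᴴ) * (P + Pᴴ) =
      (P * Q - Q * P) - (P * Qᴴ - Qᴴ * P) - (Pᴴ * Qᴴ - Qᴴ * Pᴴ) + (Pᴴ * Q - Q * Pᴴ) := by
  noncomm_ring

/-- `‖A w‖² = Σ_{μ,ν} Re⟨w, (a_μᴴ a_ν ⊗ γ_μγ_ν) w⟩` for the gamma part `A = Σ_μ a_μ ⊗ γ_μ`. -/
theorem sum_norm_sq_gammaPart [Fintype n] (F : Fin 4 → Matrix n n ℂ) (w : n × Fin 4 → ℂ) :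
    ∑ i, ‖((∑ μ, ((F μ - (F μ)ᴴ) ⊗ₖ euclideanGamma μ)) *ᵥ w) i‖ ^ 2 =
      (∑ μ, ∑ ν, star w ⬝ᵥ ((((F μ - (F μ)ᴴ)ᴴ * (F ν - (F ν)ᴴ)) ⊗ₖ
        (euclideanGamma μ * euclideanGamma ν)) *ᵥ w)).re := by
  rw [sum_norm_sq_mulVec, Matrix.conjTranspose_sum, Finset.sum_mul, form_sum]
  congr 1
  refine Finset.sum_congr rfl fun μ _ => ?_
  rw [Finset.mul_sum, form_sum]
  refine Finset.sum_congr rfl fun ν _ => ?_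
  rw [conjTranspose_kronecker, ← mul_kronecker_mul, (euclideanGamma_isHermitian μ).eq]

/-- The naive kinetic form is the diagonal of the pair sum:
`⟨w, ((Σ_μ a_μᴴa_μ) ⊗ 1) w⟩ = Σ_μ ⟨w, (a_μᴴ a_μ ⊗ γ_μγ_μ) w⟩`. -/
theorem form_naive_eq_diag [Fintype n] (F : Fin 4 → Matrix n n ℂ) (w : n × Fin 4 → ℂ) :
    star w ⬝ᵥ (((∑ μ, (F μ - (F μ)ᴴ)ᴴ * (F μ - (F μ)ᴴ)) ⊗ₖ (1 : Matrix (Fin 4) (Fin 4) ℂ)) *ᵥ w) =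
      ∑ μ, star w ⬝ᵥ ((((F μ - (F μ)ᴴ)ᴴ * (F μ - (F μ)ᴴ)) ⊗ₖ
        (euclideanGamma μ * euclideanGamma μ)) *ᵥ w) := by
  rw [sum_kronecker, form_sum]
  refine Finset.sum_congr rfl fun μ _ => ?_
  rw [euclideanGamma_mul_self]

/-- **Pair symmetrisation with the Clifford relations**: for the pair terms
`T(μ,ν) = ⟨w, (a_μᴴ a_ν ⊗ γ_μγ_ν) w⟩`,
`T(μ,ν) + T(ν,μ) = ⟨w, ((a_μᴴa_ν − a_νᴴa_μ) ⊗ γ_μγ_ν) w⟩ + δ_{μν} 2 T(μ,μ)`. -/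
theorem pair_symm [Fintype n] (F : Fin 4 → Matrix n n ℂ) (w : n × Fin 4 → ℂ) (μ ν : Fin 4) :
    star w ⬝ᵥ ((((F μ - (F μ)ᴴ)ᴴ * (F ν - (F ν)ᴴ)) ⊗ₖ (euclideanGamma μ * euclideanGamma ν)) *ᵥ w)
      + star w ⬝ᵥ ((((F ν - (F ν)ᴴ)ᴴ * (F μ - (F μ)ᴴ)) ⊗ₖ
        (euclideanGamma ν * euclideanGamma μ)) *ᵥ w) =
      star w ⬝ᵥ ((((F μ - (F μ)ᴴ)ᴴ * (F ν - (F ν)ᴴ) - (F ν - (F ν)ᴴ)ᴴ * (F μ - (F μ)ᴴ)) ⊗ₖ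
          (euclideanGamma μ * euclideanGamma ν)) *ᵥ w) +
        if μ = ν then 2 * (star w ⬝ᵥ ((((F μ - (F μ)ᴴ)ᴴ * (F μ - (F μ)ᴴ)) ⊗ₖ
          (euclideanGamma μ * euclideanGamma μ)) *ᵥ w)) else 0 := by
  by_cases h : μ = ν
  · subst h
    rw [if_pos rfl, sub_self, zero_kronecker, zero_mulVec, dotProduct_zero, zero_add, two_mul]
  · rw [if_neg h, add_zero, euclideanGamma_mul_of_ne (Ne.symm h), kronecker_neg, neg_mulVec,
      dotProduct_neg, ← sub_eq_add_neg, sub_kronecker, sub_mulVec, dotProduct_sub]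

/-- **Diagonal = full pair sum − ½ commutator sum**:
`Σ_μ T(μ,μ) = Σ_{μ,ν} T(μ,ν) − ½ Σ_{μ,ν} ⟨w, ((a_μᴴa_ν − a_νᴴa_μ) ⊗ γ_μγ_ν) w⟩`. -/
theorem diag_eq_pairSum_sub [Fintype n] (F : Fin 4 → Matrix n n ℂ) (w : n × Fin 4 → ℂ) :
    ∑ μ, star w ⬝ᵥ ((((F μ - (F μ)ᴴ)ᴴ * (F μ - (F μ)ᴴ)) ⊗ₖ
        (euclideanGamma μ * euclideanGamma μ)) *ᵥ w) =
      ∑ μ, ∑ ν, star w ⬝ᵥ ((((F μ - (F μ)ᴴ)ᴴ * (F ν - (F ν)ᴴ)) ⊗ₖ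
          (euclideanGamma μ * euclideanGamma ν)) *ᵥ w) -
        2⁻¹ * ∑ μ, ∑ ν, star w ⬝ᵥ ((((F μ - (F μ)ᴴ)ᴴ * (F ν - (F ν)ᴴ) -
          (F ν - (F ν)ᴴ)ᴴ * (F μ - (F μ)ᴴ)) ⊗ₖ (euclideanGamma μ * euclideanGamma ν)) *ᵥ w) := by
  have hsymm : ∑ μ, ∑ ν, star w ⬝ᵥ ((((F μ - (F μ)ᴴ)ᴴ * (F ν - (F ν)ᴴ)) ⊗ₖ
      (euclideanGamma μ * euclideanGamma ν)) *ᵥ w) =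
        ∑ μ, ∑ ν, star w ⬝ᵥ ((((F ν - (F ν)ᴴ)ᴴ * (F μ - (F μ)ᴴ)) ⊗ₖ
          (euclideanGamma ν * euclideanGamma μ)) *ᵥ w) := Finset.sum_comm
  have h2 : 2 * ∑ μ, ∑ ν, star w ⬝ᵥ ((((F μ - (F μ)ᴴ)ᴴ * (F ν - (F ν)ᴴ)) ⊗ₖ
      (euclideanGamma μ * euclideanGamma ν)) *ᵥ w) =
        ∑ μ, ∑ ν, (star w ⬝ᵥ ((((F μ - (F μ)ᴴ)ᴴ * (F ν - (F ν)ᴴ)) ⊗ₖ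
            (euclideanGamma μ * euclideanGamma ν)) *ᵥ w) +
          star w ⬝ᵥ ((((F ν - (F ν)ᴴ)ᴴ * (F μ - (F μ)ᴴ)) ⊗ₖ
            (euclideanGamma ν * euclideanGamma μ)) *ᵥ w)) := by
    simp only [Finset.sum_add_distrib]
    rw [← hsymm, two_mul]
  have h3 : ∑ μ, ∑ ν, (star w ⬝ᵥ ((((F μ - (F μ)ᴴ)ᴴ * (F ν - (F ν)ᴴ)) ⊗ₖ
            (euclideanGamma μ * euclideanGamma ν)) *ᵥ w) +
          star w ⬝ᵥ ((((F ν - (F ν)ᴴ)ᴴ * (F μ - (F μ)ᴴ)) ⊗ₖ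
            (euclideanGamma ν * euclideanGamma μ)) *ᵥ w)) =
      ∑ μ, ∑ ν, star w ⬝ᵥ ((((F μ - (F μ)ᴴ)ᴴ * (F ν - (F ν)ᴴ) -
          (F ν - (F ν)ᴴ)ᴴ * (F μ - (F μ)ᴴ)) ⊗ₖ (euclideanGamma μ * euclideanGamma ν)) *ᵥ w) +
        2 * ∑ μ, star w ⬝ᵥ ((((F μ - (F μ)ᴴ)ᴴ * (F μ - (F μ)ᴴ)) ⊗ₖ
          (euclideanGamma μ * euclideanGamma μ)) *ᵥ w) := by
    simp only [pair_symm, Finset.sum_add_distrib, Finset.sum_ite_eq, Finset.mem_univ, if_true,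
      Finset.mul_sum]
  linear_combination (-(2 : ℂ)⁻¹) * h2 - (2 : ℂ)⁻¹ * h3

/-- **Abstract naive kinetic bound** (`F_μ` arbitrary, `r` real): with
`M = r − Σ_μ (F_μ+F_μᴴ) ⊗ 1`, `A = Σ_μ (F_μ−F_μᴴ) ⊗ γ_μ`,
`Re⟨w, (Σ_μ a_μᴴa_μ ⊗ 1) w⟩ ≤ ‖(M + A) w‖² + Σ_{μ,ν} |⟨w, ([F_μ+F_μᴴ, a_ν] ⊗ γ_ν) w⟩|
  + ½ Σ_{μ,ν} |⟨w, ((a_μᴴa_ν − a_νᴴa_μ) ⊗ γ_μγ_ν) w⟩|`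
(square completion: `‖(M+A)w‖² = ‖Mw‖² + ‖Aw‖² + Re⟨w,[M,A]w⟩`, drop `‖Mw‖²`). -/
theorem abstract_naiveKinetic [Fintype n] [DecidableEq n] (F : Fin 4 → Matrix n n ℂ) (r : ℝ) (w : n × Fin 4 → ℂ) :
    (star w ⬝ᵥ (((∑ μ, (F μ - (F μ)ᴴ)ᴴ * (F μ - (F μ)ᴴ)) ⊗ₖ (1 : Matrix (Fin 4) (Fin 4) ℂ))
        *ᵥ w)).re ≤
      ∑ i, ‖((((r : ℂ) • (1 : Matrix (n × Fin 4) (n × Fin 4) ℂ) -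
            ∑ μ, ((F μ + (F μ)ᴴ) ⊗ₖ (1 : Matrix (Fin 4) (Fin 4) ℂ))) +
          ∑ μ, ((F μ - (F μ)ᴴ) ⊗ₖ euclideanGamma μ)) *ᵥ w) i‖ ^ 2 +
        ∑ μ, ∑ ν, ‖star w ⬝ᵥ (((((F μ + (F μ)ᴴ) * (F ν - (F ν)ᴴ) -
          (F ν - (F ν)ᴴ) * (F μ + (F μ)ᴴ))) ⊗ₖ euclideanGamma ν) *ᵥ w)‖ +
        2⁻¹ * ∑ μ, ∑ ν, ‖star w ⬝ᵥ ((((F μ - (F μ)ᴴ)ᴴ * (F ν - (F ν)ᴴ) -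
          (F ν - (F ν)ᴴ)ᴴ * (F μ - (F μ)ᴴ)) ⊗ₖ (euclideanGamma μ * euclideanGamma ν)) *ᵥ w)‖ := by
  rw [sum_norm_sq_mulVec_add_of_comm _ _ (massPart_conjTranspose F r) (gammaPart_conjTranspose F) w,
    comm_massPart_gammaPart, neg_mulVec, dotProduct_neg, Complex.neg_re, form_sum, form_naive_eq_diag,
    diag_eq_pairSum_sub, Complex.sub_re, ← sum_norm_sq_gammaPart]
  have hM : 0 ≤ ∑ i, ‖((((r : ℂ) • (1 : Matrix (n × Fin 4) (n × Fin 4) ℂ) -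
      ∑ μ, ((F μ + (F μ)ᴴ) ⊗ₖ (1 : Matrix (Fin 4) (Fin 4) ℂ)))) *ᵥ w) i‖ ^ 2 :=
    Finset.sum_nonneg fun _ _ => sq_nonneg _
  have hY : (∑ μ, star w ⬝ᵥ ((∑ ν, (((F μ + (F μ)ᴴ) * (F ν - (F ν)ᴴ) -
      (F ν - (F ν)ᴴ) * (F μ + (F μ)ᴴ)) ⊗ₖ euclideanGamma ν)) *ᵥ w)).re ≤
        ∑ μ, ∑ ν, ‖star w ⬝ᵥ (((((F μ + (F μ)ᴴ) * (F ν - (F ν)ᴴ) -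
          (F ν - (F ν)ᴴ) * (F μ + (F μ)ᴴ))) ⊗ₖ euclideanGamma ν) *ᵥ w)‖ := by
    refine (Complex.re_le_norm _).trans ((norm_sum_le _ _).trans (Finset.sum_le_sum fun μ _ => ?_))
    rw [form_sum]
    exact norm_sum_le _ _
  have hX : -(2⁻¹ * ∑ μ, ∑ ν, star w ⬝ᵥ ((((F μ - (F μ)ᴴ)ᴴ * (F ν - (F ν)ᴴ) -
      (F ν - (F ν)ᴴ)ᴴ * (F μ - (F μ)ᴴ)) ⊗ₖ (euclideanGamma μ * euclideanGamma ν)) *ᵥ w)).re ≤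
        2⁻¹ * ∑ μ, ∑ ν, ‖star w ⬝ᵥ ((((F μ - (F μ)ᴴ)ᴴ * (F ν - (F ν)ᴴ) -
          (F ν - (F ν)ᴴ)ᴴ * (F μ - (F μ)ᴴ)) ⊗ₖ (euclideanGamma μ * euclideanGamma ν)) *ᵥ w)‖ := by
    rw [← Complex.neg_re]
    refine (Complex.re_le_norm _).trans ?_
    rw [norm_neg, norm_mul, norm_inv, Complex.norm_two]
    refine mul_le_mul_of_nonneg_left ((norm_sum_le _ _).trans
      (Finset.sum_le_sum fun μ _ => norm_sum_le _ _)) (by norm_num)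
  linarith

/-- Entries of `γ_ν` have modulus at most `1`. -/
theorem norm_gamma_apply_le (ν : Fin 4) (α β : Fin 4) : ‖euclideanGamma ν α β‖ ≤ 1 :=
  Summit.QuantumFields.QCD.Theorems.HeatSlicedQuarksDaviesGaffney.norm_euclideanGamma_apply_le ν α β

/-- Entries of `γ_μ γ_ν` have modulus at most `1` (a product of unitaries is unitary). -/
theorem norm_gamma_mul_gamma_apply_le (μ ν : Fin 4) (α β : Fin 4) :
    ‖(euclideanGamma μ * euclideanGamma ν) α β‖ ≤ 1 :=
  entry_norm_bound_of_unitary (mul_mem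
    (Summit.QuantumFields.QCD.Theorems.HeatSlicedQuarksDaviesGaffney.euclideanGamma_mem_unitaryGroup μ)
    (Summit.QuantumFields.QCD.Theorems.HeatSlicedQuarksDaviesGaffney.euclideanGamma_mem_unitaryGroup ν))
    α β

/-- **Abstract naive kinetic bound with commutator control**: if every commutator form
`|⟨w, ([F_μ^♯, F_ν^♭] ⊗ Γ) w⟩|` (`♯,♭ ∈ {·,ᴴ}`, `|Γ_{αβ}| ≤ 1`) is at most `B`, then
`Re⟨w, (Σ_μ a_μᴴa_μ ⊗ 1) w⟩ ≤ ‖(M + A) w‖² + 96 B` (`16` pairs, four commutators each, weights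
`1` and `½`). -/
theorem abstract_naiveKinetic_le [Fintype n] [DecidableEq n] (F : Fin 4 → Matrix n n ℂ) (r : ℝ)
    (w : n × Fin 4 → ℂ) (B : ℝ)
    (h₁ : ∀ (μ ν : Fin 4) (Γ : Matrix (Fin 4) (Fin 4) ℂ), (∀ α β, ‖Γ α β‖ ≤ 1) →
      ‖star w ⬝ᵥ (((F μ * F ν - F ν * F μ) ⊗ₖ Γ) *ᵥ w)‖ ≤ B)
    (h₂ : ∀ (μ ν : Fin 4) (Γ : Matrix (Fin 4) (Fin 4) ℂ), (∀ α β, ‖Γ α β‖ ≤ 1) →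
      ‖star w ⬝ᵥ (((F μ * (F ν)ᴴ - (F ν)ᴴ * F μ) ⊗ₖ Γ) *ᵥ w)‖ ≤ B)
    (h₃ : ∀ (μ ν : Fin 4) (Γ : Matrix (Fin 4) (Fin 4) ℂ), (∀ α β, ‖Γ α β‖ ≤ 1) →
      ‖star w ⬝ᵥ ((((F μ)ᴴ * F ν - F ν * (F μ)ᴴ) ⊗ₖ Γ) *ᵥ w)‖ ≤ B)
    (h₄ : ∀ (μ ν : Fin 4) (Γ : Matrix (Fin 4) (Fin 4) ℂ), (∀ α β, ‖Γ α β‖ ≤ 1) →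
      ‖star w ⬝ᵥ ((((F μ)ᴴ * (F ν)ᴴ - (F ν)ᴴ * (F μ)ᴴ) ⊗ₖ Γ) *ᵥ w)‖ ≤ B) :
    (star w ⬝ᵥ (((∑ μ, (F μ - (F μ)ᴴ)ᴴ * (F μ - (F μ)ᴴ)) ⊗ₖ (1 : Matrix (Fin 4) (Fin 4) ℂ))
        *ᵥ w)).re ≤
      ∑ i, ‖((((r : ℂ) • (1 : Matrix (n × Fin 4) (n × Fin 4) ℂ) -
            ∑ μ, ((F μ + (F μ)ᴴ) ⊗ₖ (1 : Matrix (Fin 4) (Fin 4) ℂ))) +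
          ∑ μ, ((F μ - (F μ)ᴴ) ⊗ₖ euclideanGamma μ)) *ᵥ w) i‖ ^ 2 + 96 * B := by
  have hY : ∀ μ ν, ‖star w ⬝ᵥ (((((F μ + (F μ)ᴴ) * (F ν - (F ν)ᴴ) -
      (F ν - (F ν)ᴴ) * (F μ + (F μ)ᴴ))) ⊗ₖ euclideanGamma ν) *ᵥ w)‖ ≤ 4 * B := fun μ ν => by
    rw [sym_skew_expand]
    exact norm_form_four_le _ _ _ _ _ w _ (h₁ μ ν _ (norm_gamma_apply_le ν))
      (h₂ μ ν _ (norm_gamma_apply_le ν)) (h₄ μ ν _ (norm_gamma_apply_le ν))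
      (h₃ μ ν _ (norm_gamma_apply_le ν))
  have hX : ∀ μ ν, ‖star w ⬝ᵥ ((((F μ - (F μ)ᴴ)ᴴ * (F ν - (F ν)ᴴ) -
      (F ν - (F ν)ᴴ)ᴴ * (F μ - (F μ)ᴴ)) ⊗ₖ (euclideanGamma μ * euclideanGamma ν)) *ᵥ w)‖ ≤
        4 * B := fun μ ν => by
    rw [skew_pair_expand]
    exact norm_form_four_le _ _ _ _ _ w _ (h₃ μ ν _ (norm_gamma_mul_gamma_apply_le μ ν))
      (h₄ μ ν _ (norm_gamma_mul_gamma_apply_le μ ν)) (h₁ μ ν _ (norm_gamma_mul_gamma_apply_le μ ν))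
      (h₂ μ ν _ (norm_gamma_mul_gamma_apply_le μ ν))
  have h1 := Finset.sum_le_sum fun μ (_ : μ ∈ Finset.univ) =>
    Finset.sum_le_sum fun ν (_ : ν ∈ Finset.univ) => hY μ ν
  have h2 := Finset.sum_le_sum fun μ (_ : μ ∈ Finset.univ) =>
    Finset.sum_le_sum fun ν (_ : ν ∈ Finset.univ) => hX μ ν
  simp only [Finset.sum_const, Finset.card_univ, Fintype.card_fin, nsmul_eq_mul, Nat.cast_ofNat]
    at h1 h2
  have h0 := abstract_naiveKinetic F r w
  linarith

end Algebra

/-! ## Transport through `reindex` and the proof of the stub -/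
section Transport

variable {m k : Type*} [Fintype m] [Fintype k]

/-- `⟨v, (reindex e e X) v⟩ = ⟨v ∘ e, X (v ∘ e)⟩`. -/
theorem form_reindex (e : m ≃ k) (X : Matrix m m ℂ) (v : k → ℂ) :
    star v ⬝ᵥ ((Matrix.reindex e e X) *ᵥ v) = star (v ∘ e) ⬝ᵥ (X *ᵥ (v ∘ e)) := by
  rw [Matrix.reindex_apply, Matrix.submatrix_mulVec_equiv, Equiv.symm_symm,
    dotProduct_comp_equiv_symm]
  rfl

/-- `Σ_i ‖((reindex e e X) v) i‖² = Σ_j ‖(X (v ∘ e)) j‖²`. -/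
theorem sum_norm_sq_reindex_mulVec (e : m ≃ k) (X : Matrix m m ℂ) (v : k → ℂ) :
    ∑ i, ‖((Matrix.reindex e e X) *ᵥ v) i‖ ^ 2 = ∑ j, ‖(X *ᵥ (v ∘ e)) j‖ ^ 2 := by
  rw [Matrix.reindex_apply, Matrix.submatrix_mulVec_equiv, Equiv.symm_symm]
  exact Equiv.sum_comp e.symm (fun j => ‖(X *ᵥ (v ∘ e)) j‖ ^ 2)

end Transport

section Final

variable {L : ℕ} [NeZero L]

/-- **Stub A (`stub_naiveKinetic`, all masses).**  There is an absolute `C` (here `41472`) such that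
for every torus, every `SU(3)` field `U`, EVERY real mass `m` and every quark field `v`,
`Re⟨v, Tn(U) v⟩ ≤ 4 Σ_i |(D_W(U,m,1)v)_i|² + C Σ_x V(U,x) Σ_{a,α}|v(x,a,α)|²`
(`Tn(U) = reindex((Σ_μ (F_μ − F_μᴴ)ᴴ(F_μ − F_μᴴ)) ⊗ 1₄)`, `F_μ = linkHop ρ₃ U μ`, `V` the curvature
potential of `WilsonLichnerowicz`); see the module docstring for the proof. -/
theorem stub_naiveKinetic :
    ∃ C : ℝ, ∀ (L : ℕ) [NeZero L] (U : GaugeConfig 4 L ↥(Matrix.specialUnitaryGroup (Fin 3) ℂ))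
      (m : ℝ) (v : TorusSite 4 L × Fin 3 × Fin 4 → ℂ),
      (star v ⬝ᵥ ((Matrix.reindex (Equiv.prodAssoc (TorusSite 4 L) (Fin 3) (Fin 4))
            (Equiv.prodAssoc (TorusSite 4 L) (Fin 3) (Fin 4))
          ((∑ μ : Fin 4, (linkHop (fundamentalRep (Fin 3)) U μ - (linkHop (fundamentalRep (Fin 3)) U μ)ᴴ)ᴴ *
              (linkHop (fundamentalRep (Fin 3)) U μ - (linkHop (fundamentalRep (Fin 3)) U μ)ᴴ)) ⊗ₖ
            (1 : Matrix (Fin 4) (Fin 4) ℂ))) *ᵥ v)).re ≤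
        4 * (∑ i, ‖(wilsonDirac (fundamentalRep (Fin 3)) U m 1 *ᵥ v) i‖ ^ 2) +
          C * ∑ x : TorusSite 4 L,
            (∑ y ∈ Finset.univ.filter (fun y : TorusSite 4 L => torusDist x y ≤ 3),
                ∑ μ : Fin 4, ∑ ν : Fin 4,
                  Real.sqrt (3 - ((fundamentalRep (Fin 3)) (plaquetteHolonomy U y μ ν)).trace.re)) *
              ∑ a : Fin 3, ∑ α : Fin 4, ‖v (x, a, α)‖ ^ 2 := by
  refine ⟨41472, fun L _ U m v => ?_⟩
  have hD : wilsonDirac (fundamentalRep (Fin 3)) U m 1 =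
      Matrix.reindex (Equiv.prodAssoc (TorusSite 4 L) (Fin 3) (Fin 4))
        (Equiv.prodAssoc (TorusSite 4 L) (Fin 3) (Fin 4))
        (((m + 4 : ℝ) : ℂ) • (1 : Matrix ((TorusSite 4 L × Fin 3) × Fin 4)
            ((TorusSite 4 L × Fin 3) × Fin 4) ℂ) -
          ∑ μ, (linkHop (fundamentalRep (Fin 3)) U μ ⊗ₖ chiralProjMinus μ +
            (linkHop (fundamentalRep (Fin 3)) U μ)ᴴ ⊗ₖ chiralProjPlus μ)) := by
    rw [wilsonDirac_eq_sub_sum_wilsonHop (fundamentalRep (Fin 3)) fundamentalRep_mem_unitaryGroup U m]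
    change _ = Matrix.reindexAlgEquiv ℂ ℂ (Equiv.prodAssoc (TorusSite 4 L) (Fin 3) (Fin 4)) _
    rw [map_sub, map_smul, map_one, map_sum]
    rfl
  rw [form_reindex, hD, sum_norm_sq_reindex_mulVec]
  have key := abstract_naiveKinetic_le (linkHop (fundamentalRep (Fin 3)) U) (2 * (m + 4))
    (v ∘ Equiv.prodAssoc (TorusSite 4 L) (Fin 3) (Fin 4)) _
    (fun μ ν Γ hΓ => stub_naiveKineticDefect L U μ ν Γ hΓ _)
    (fun μ ν Γ hΓ => form_comm_conjTranspose_le_curv U μ ν Γ hΓ _)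
    (fun μ ν Γ hΓ => form_conjTranspose_comm_le_curv U μ ν Γ hΓ _)
    (fun μ ν Γ hΓ => form_conjTranspose_comm_conjTranspose_le_curv U μ ν Γ hΓ _)
  have hc : ((2 * (m + 4) : ℝ) : ℂ) = 2 * ((m + 4 : ℝ) : ℂ) := by push_cast; ring
  have h4 : ‖(2 : ℂ)‖ ^ 2 = 4 := by rw [Complex.norm_two]; norm_num
  rw [hc, ← two_smul_core (linkHop (fundamentalRep (Fin 3)) U) ((m + 4 : ℝ) : ℂ),
    sum_norm_sq_smul_mulVec, h4] at key
  simp only [Function.comp_apply, Equiv.prodAssoc_apply] at key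
  linarith

end Final

end Summit.QuantumFields.QCD.Cruxes.ActionBoundsLowModes.DropTheWilsonSquare
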